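import Summits.ResolutionOfSingularities.ResolutionOfSingularities.Theorems.DeltaCutStellarNR
import Summits.ResolutionOfSingularities.ResolutionOfSingularities.Theorems.DeltaCutStellarLowInhabitant

/-!
# StellarCut N23e — «NonResonant»: the KERNEL INHABITANT at a COMPOSITE MARKING OUTSIDE the low-residue class —
# g34's witness `x₀⁴ + x₁³x₂³` over `𝔽₂`, marking `4`, labels `(0, 3, 3)` (lens-6 «barrier-complement carving», g37 door 4)

In T19d's model `S = 𝔽₂[x₀, x₁, x₂]_{(x₀,x₁,x₂)}`, `Xs = Spec S`, frame members `D j = (x j)~`, `H = D 0`: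

* `nr = (0, 3, 3)`, `fN = x₀⁴ + x₁³·x₂³`, `MN = (fN~, 4)` — characteristic `p = 2`, marking `n = 4 = 2·2` (COMPOSITE), labels of
  residues `3 % 4 = 3`: NON-RESONANT (`≠ 0`) but NOT LOW (`3 ≥ 2 = p`): ★ `ncHypShapeNR_nr : ncHypShapeNR 4 Xs (frame nr) H MN`
  (N23c's class) and, IN THE KERNEL, `not_ncHypShapeLow_nr (p) : ¬ ncHypShapeLow p 4 Xs (frame nr) H MN` for EVERY `p` (cn42: the
  low-residue class R22a is a decided kind — non-membership is mandatory and proved, not weightless), with `nr_nondegenerate` (s.n.c.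
  frame through `H`, the closed point of order `4` lying on ALL THREE members — the label clauses at `D 1`, `D 2` are exercised, not
  escaped) and ★★ `weakResolution_nr` BY THE NON-RESONANT LIST LAW (N23c `ncHypShapeNR.exists_weakResolution`), standard axioms.
* cn42 — KERNEL NON-MEMBERSHIP in every previously decided class, on the nose: `not_ncHypShapeLow_nr` (R22a, every `p`),
  `not_ncHypShapeCop_nr`, `not_ncHypShapeJet_nr`, `not_ncHypShapeLat_nr`, `not_ncHypShapeLatJ_nr` (T18/T19/L20/J21 record a PRIME
  marking; `MN.mult = 4`), and `not_ncHypShape_nr` (T10's tame class needs `4` a unit in the stalks; `4 = 2·2 = 0`).  So the datum lies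
  in the cell `WORNCHypWildNR 4`'s class and in NO cell decided before — it is g34's own test datum for the family (iii-b) «residue ≥ p»
  of the located residual `WORNCHypWildRest5` (R22b), found dead there for Cop/Jet because its star strategy passes a TIGHT face with
  EVEN labels `(2, 2)`; the companion file N23f certifies that tight face in the kernel (`not_safeFace_tight`, the exact guard).

The support computation uses the derivation `∂/∂x₁` (`∂fN/∂x₁ = 3x₁²x₂³ = x₁²x₂³`): `fN ∈ 𝔪_𝔭⁴ ⊆ 𝔪_𝔭² ⇒ x₁²x₂³ ∈ 𝔭 ⇒ x₁³x₂³ ∈ 𝔭 ⇒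
x₀⁴ = fN − x₁³x₂³ ∈ 𝔭`.  Cell-level (`IsBase`-) inhabitation of `WORNCHypWildNR 4` is NOT claimed (no concrete `IsBase` instance in the
tree; debt (d) of the critic's ledger stays owed at 0) — this is the LIST-LEVEL inhabitant of the class the cell's bridge produces.

0 sorry; axioms standard. [new] [cite: Kollar2007, (3.111) Step 3] [cite: Hauser2010, §5]
-/

noncomputable section

open CategoryTheory CategoryTheory.Limits AlgebraicGeometry TopologicalSpace IsLocalRing
open Literature.AlgebraicGeometry.Resolution

namespace Summit.ResolutionOfSingularities.ResolutionOfSingularities.Theorems.DeltaCutClasses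

open Summit.ResolutionOfSingularities.ResolutionOfSingularities.Theorems
open WeakOrderReduction ForcedTowerClasses

namespace JetModel

/-! ## The datum `x₀⁴ + x₁³x₂³` on the frame `(V(x₀); x₁ : 3, x₂ : 3)`, marking `4` -/

/-- labels `(0, 3, 3)` on `(D 0, D 1, D 2)`: residues mod `4` are `(0, 3, 3)` — non-resonant, not low at `p = 2`. -/
def nr : Fin 3 → ℕ := ![0, 3, 3]

/-- Label of `H = D 0` is `0`. [folklore] -/
@[simp] theorem nr_zero : nr 0 = 0 := rfl
/-- Label of `D 1` is `3`. [folklore] -/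
@[simp] theorem nr_one : nr 1 = 3 := rfl
/-- Label of `D 2` is `3`. [folklore] -/
@[simp] theorem nr_two : nr 2 = 3 := rfl

/-- ★ the labels are NON-RESONANT at the marking `4` (`0`, or residue `≠ 0`) … -/
theorem nr_nonres (j : Fin 3) : nr j = 0 ∨ nr j % 4 ≠ 0 := by
  revert j; decide

/-- … but NOT LOW-RESIDUE at `(p, n) = (2, 4)` (R22a's clause fails at `D 1`: the residue `3 % 4 = 3` is not `< 2`), not a multiple
of the marking, and not coprime to the characteristic's square: `2 ∤ 3`, `4 ∤ 3`, `¬ 3 % 4 < 2`. -/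
theorem nr_one_facts : ¬ 2 ∣ nr 1 ∧ ¬ 4 ∣ nr 1 ∧ ¬ nr 1 % 4 < 2 := by decide

/-- `fN = x₀⁴ + x₁³·x₂³` (g34's witness). -/
noncomputable abbrev fN : S := x 0 ^ 4 + x 1 ^ 3 * x 2 ^ 3

/-- the marked ideal `(fN~, 4)` — marking `4 = 2·2`, COMPOSITE. -/
noncomputable def MN : MarkedIdeal Xs := ⟨affineBlowup.idealSheaf (Ideal.span {fN}), [], 4⟩

/-- The ideal of the datum is `(fN)`. [folklore] -/
theorem MN_ideal : MN.ideal = affineBlowup.idealSheaf (Ideal.span {fN}) := rfl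

/-- The marking of the datum is `4`. [folklore] -/
theorem MN_mult : MN.mult = 4 := rfl

/-- The frame monomial of the labels `nr` is `x₁³x₂³`. [folklore] -/
theorem prod_nr : ∏ j, x j ^ nr j = x 1 ^ 3 * x 2 ^ 3 := by
  simp [Fin.prod_univ_three]

/-- The monomial ideal sheaf of `frame nr` is `(x₁³x₂³)`. [folklore] -/
theorem monomialIdeal_nr : monomialIdeal (frame nr) = affineBlowup.idealSheaf (Ideal.span {x 1 ^ 3 * x 2 ^ 3}) := by
  rw [monomialIdeal_frame, prod_nr]

/-- `∂fN/∂x₁ = 3·x₁²x₂³ = x₁²x₂³` in `S` (`3 = 1` in characteristic `2`). [folklore] -/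
theorem exists_isDeriv_fN : ∃ δ : S → S, IsDeriv δ ∧ δ fN = x 1 ^ 2 * x 2 ^ 3 := by
  obtain ⟨δ, hδ, he⟩ := (IsDeriv.of_derivation (MvPolynomial.pderiv (R := ZMod 2) (σ := Fin 3) 1)).exists_extend S
    (originIdeal (ZMod 2) 3).primeCompl
  refine ⟨δ, hδ, ?_⟩
  have hF : fN = algebraMap P S (MvPolynomial.X 0 ^ 4 + MvPolynomial.X 1 ^ 3 * MvPolynomial.X 2 ^ 3) := by
    simp only [map_add, map_mul, map_pow]
  have h1 : MvPolynomial.pderiv (1 : Fin 3) (MvPolynomial.X 0 ^ 4 : P) = 0 := by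
    rw [Derivation.leibniz_pow, MvPolynomial.pderiv_X_of_ne (show (0 : Fin 3) ≠ 1 by decide)]
    simp only [smul_zero]
  have h2 : MvPolynomial.pderiv (1 : Fin 3) (MvPolynomial.X 1 ^ 3 * MvPolynomial.X 2 ^ 3 : P) =
      3 * (MvPolynomial.X 1 ^ 2 * MvPolynomial.X 2 ^ 3) := by
    simp only [Derivation.leibniz, Derivation.leibniz_pow, MvPolynomial.pderiv_X_self,
      MvPolynomial.pderiv_X_of_ne (show (2 : Fin 3) ≠ 1 by decide), smul_eq_mul, mul_one, smul_zero, mul_zero, zero_add,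
      nsmul_eq_mul, Nat.cast_ofNat]
    ring
  have hd : MvPolynomial.pderiv (1 : Fin 3) (MvPolynomial.X 0 ^ 4 + MvPolynomial.X 1 ^ 3 * MvPolynomial.X 2 ^ 3 : P) =
      3 * (MvPolynomial.X 1 ^ 2 * MvPolynomial.X 2 ^ 3) := by
    rw [map_add, h1, h2, zero_add]
  rw [hF, he, hd, map_mul, map_ofNat, three_eq_one, one_mul, map_mul, map_pow, map_pow]

/-- **`Supp(fN~, 4) ⊆ V(x₀)`** — via `∂/∂x₁`: `fN ∈ 𝔪_𝔭⁴ ⊆ 𝔪_𝔭² ⇒ x₁²x₂³ ∈ 𝔭 ⇒ x₁ ∈ 𝔭 ∨ x₂ ∈ 𝔭 ⇒ x₁³x₂³ ∈ 𝔭 ⇒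
x₀⁴ = fN − x₁³x₂³ ∈ 𝔭 ⇒ x₀ ∈ 𝔭`. [folklore] -/
theorem support_MN_subset : (MN.support : Set Xs) ⊆ H.support := by
  intro p hp
  letI := stalkAlgebra p
  haveI := isLocalizationAtPrime_stalk p
  have hle : stalkIdeal MN.ideal p ≤ maximalIdeal _ ^ 4 := (MarkedIdeal.mem_support_iff MN p).mp hp
  rw [MN_ideal, stalkIdeal_span] at hle
  have hf4 : φ p fN ∈ maximalIdeal _ ^ 4 := hle (Ideal.mem_span_singleton_self _)
  have hf2 : φ p fN ∈ maximalIdeal _ ^ 2 := Ideal.pow_le_pow_right (by norm_num) hf4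
  have hf1 : fN ∈ p.asIdeal := (mem_maximalIdeal_iff p fN).mp (Ideal.pow_le_self (by norm_num) hf4)
  obtain ⟨δ, hδ, hf⟩ := exists_isDeriv_fN
  obtain ⟨δ', hδ', he⟩ := hδ.exists_extend (Xs.presheaf.stalk p) p.asIdeal.primeCompl
  have h23 : x 1 ^ 2 * x 2 ^ 3 ∈ p.asIdeal := by
    rw [← mem_maximalIdeal_iff p, ← hf, show φ p (δ fN) = algebraMap S _ (δ fN) from rfl, ← he]
    exact hδ'.apply_mem_of_mem_sq _ hf2
  have h33 : x 1 ^ 3 * x 2 ^ 3 ∈ p.asIdeal := by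
    rcases p.2.mem_or_mem h23 with h1 | h2
    · exact p.asIdeal.mul_mem_right _ (p.asIdeal.pow_mem_of_mem (p.2.mem_of_pow_mem 2 h1) 3 (by norm_num))
    · exact p.asIdeal.mul_mem_left _ h2
  have hx0 : x 0 ^ 4 ∈ p.asIdeal := by
    have := p.asIdeal.sub_mem hf1 h33
    rwa [add_sub_cancel_right] at this
  exact (mem_support_D 0 p).mpr (p.2.mem_of_pow_mem 4 hx0)

/-- **the unit-free NC-hyp shape (T17a) of the datum at marking `4`**: `fN = h⁴ + 1·m`, `h = x₀`, `m = x₁³x₂³`. [new] -/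
theorem ncHypShapeF_nr : ncHypShapeF 4 Xs (frame nr) H MN := by
  refine ⟨rfl, fun q hq hqH => ?_, fun y _ => ?_, support_MN_subset⟩
  · obtain ⟨j, rfl⟩ := (List.mem_ofFn' _ _).mp hq
    have hj : j = 0 := D_injective hqH
    subst hj
    exact Or.inl rfl
  · refine ⟨φ y (x 0), φ y (x 1 ^ 3 * x 2 ^ 3), 1, isUnit_one, stalkIdeal_span _ _, ?_, ?_⟩
    · rw [monomialIdeal_nr, stalkIdeal_span]
    · rw [MN_ideal, stalkIdeal_span, one_mul, ← map_pow, ← map_add]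

/-- ★ **THE DATUM IS IN THE NON-RESONANT CLASS** `ncHypShapeNR 4` (N23c): T17a's shape at marking `4 ≠ 0`, and every label in
the support of its member is `0` or of residue `≠ 0` mod `4` — labels `(0, 3, 3)`.  KERNEL INHABITANT of the class of the cell
`WORNCHypWildNR 4` at the COMPOSITE marking `4 = 2·2`, OUTSIDE the low-residue class (cn41/cn42). [new] -/
theorem ncHypShapeNR_nr : ncHypShapeNR 4 Xs (frame nr) H MN := by
  refine ⟨ncHypShapeF_nr, by norm_num, fun K y _ => ?_⟩
  by_cases hj : ∃ j, D j = K
  · obtain ⟨j, rfl⟩ := hj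
    rw [expOf_frame]
    exact nr_nonres j
  · exact Or.inl (expOf_frame_eq_zero nr fun j h => hj ⟨j, h⟩)

/-- **non-degeneracy**: the closed point is a point of order `4` of `fN`, i.e. `pt ∈ Supp(MN)` (`x₀⁴ ∈ 𝔪⁴`, `x₁³x₂³ ∈ 𝔪⁶ ⊆ 𝔪⁴`). -/
theorem pt_mem_support_MN : pt ∈ MN.support := by
  rw [MarkedIdeal.mem_support_iff, MN_ideal, stalkIdeal_span, MN_mult, Ideal.span_le, Set.singleton_subset_iff,
    SetLike.mem_coe, maximalIdeal_stalk_eq, pt_asIdeal, ← Ideal.map_pow]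
  refine Ideal.mem_map_of_mem _ (Ideal.add_mem _ (Ideal.pow_mem_pow (x_mem 0) 4) ?_)
  have h6 : x 1 ^ 3 * x 2 ^ 3 ∈ maximalIdeal S ^ 6 := by
    rw [show (6 : ℕ) = 3 + 3 from rfl, pow_add]
    exact Ideal.mul_mem_mul (Ideal.pow_mem_pow (x_mem 1) 3) (Ideal.pow_mem_pow (x_mem 2) 3)
  exact Ideal.pow_le_pow_right (by norm_num) h6

/-- ★ **NON-DEGENERACY RECORD**: s.n.c. frame through `H`, `H` a member, the closed point in the support AND on all three members (so the
non-resonance clauses at `D 1`, `D 2` (labels `3`, `3`) are EXERCISED at `pt`, not escaped through an empty support). [new] -/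
theorem nr_nondegenerate :
    HasSNC (H :: boundaryOf (frame nr)) ∧ H ∈ boundaryOf (frame nr) ∧ pt ∈ MN.support ∧
      pt ∈ (D 1).support ∧ pt ∈ (D 2).support ∧ expOf (frame nr) (D 1) = 3 ∧ expOf (frame nr) (D 2) = 3 :=
  ⟨hasSNC_frame _, H_mem_boundaryOf_frame _, pt_mem_support_MN, pt_mem_support_D 1, pt_mem_support_D 2, expOf_frame nr 1,
    expOf_frame nr 2⟩

/-- ★★ **A WEAK RESOLUTION OF `x₀⁴ + x₁³x₂³` AT MARKING `4` IN CHARACTERISTIC `2`, by the non-resonant list law (N23c)** — g34's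
test datum of the family (iii-b), resolved through its tight even-labelled faces by the exact-face Hasse guard (N23a/N23b). [new]
[cite: Kollar2007, (3.111) Step 3] -/
theorem weakResolution_nr : ∃ s : CentreSeq Xs, WeakResolution s MN :=
  ncHypShapeNR_nr.exists_weakResolution (hasSNC_frame _) (H_mem_boundaryOf_frame _)

/-! ## cn42 — kernel NON-membership in every previously decided class -/

/-- ★ **NOT in R22a's LOW-RESIDUE class, at ANY `p`** (the decided kind of ROW 253): the class records `p` prime with `p ∣ 4`, so
`p = 2`, and asks the residue of the label at `D 1` along `V(x₁) ∋ pt` to be `< p`; but `3 % 4 = 3 ≥ 2`. KERNEL non-membership. [new] -/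
theorem not_ncHypShapeLow_nr (p : ℕ) : ¬ ncHypShapeLow p 4 Xs (frame nr) H MN := fun hP => by
  have hp2 : p ∣ 2 := hP.prime.dvd_of_dvd_pow (show p ∣ 2 ^ 2 by norm_num; exact hP.dvd)
  have hp : p ≤ 2 := Nat.le_of_dvd two_pos hp2
  have h := hP.labels (K := D 1) (pt_mem_support_D 1)
  rw [expOf_frame, nr_one] at h
  omega

/-- **NOT in T18's coprime class** at any marking `q` (the class records `MN.mult = q` and `q` prime; `MN.mult = 4`). [new] -/
theorem not_ncHypShapeCop_nr (q : ℕ) : ¬ ncHypShapeCop q Xs (frame nr) H MN := by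
  intro hP
  obtain rfl : 4 = q := hP.toF.mult_eq
  exact absurd hP.prime (by decide)

/-- **NOT in T19's jet class** at any marking `q`. [new] -/
theorem not_ncHypShapeJet_nr (q : ℕ) : ¬ ncHypShapeJet q Xs (frame nr) H MN := by
  intro hP
  obtain rfl : 4 = q := hP.toF.mult_eq
  exact absurd hP.prime (by decide)

/-- **NOT in L20's latent class** at any marking `q`, for any latent labelling `L`. [new] -/
theorem not_ncHypShapeLat_nr (q : ℕ) (L : List (Xs.IdealSheafData × ℕ)) : ¬ ncHypShapeLat q Xs (frame nr) L H MN := by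
  intro hP
  obtain rfl : 4 = q := hP.mult_eq
  exact absurd hP.prime (by decide)

/-- **NOT in J21's latent-jet class** at any marking `q`, for any latent labelling `L`. [new] -/
theorem not_ncHypShapeLatJ_nr (q : ℕ) (L : List (Xs.IdealSheafData × ℕ)) : ¬ ncHypShapeLatJ q Xs (frame nr) L H MN := by
  intro hP
  obtain rfl : 4 = q := hP.mult_eq
  exact absurd hP.prime (by decide)

/-- **NOT in T10's tame class** at the marking (`ncHypShape 4` needs `4` a unit in the stalks; `4 = 0` there). [new] -/
theorem not_ncHypShape_nr : ¬ ncHypShape 4 Xs (frame nr) H MN := fun hP =>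
  not_isUnit_zero ((four_eq_zero_stalk pt) ▸ hP.isUnit_natCast pt)

/-- **at a PRIME marking the non-resonant class IS T18's coprime class** (N23c `ncHypShapeNR.toCop`; the p = n edge carries no content):
recorded on the datum's currency — any non-resonant datum of T19d's model at marking `2` is coprime. [new] -/
theorem ncHypShapeCop_of_nr_two {a : Fin 3 → ℕ} {M : MarkedIdeal Xs} (hP : ncHypShapeNR 2 Xs (frame a) H M) :
    ncHypShapeCop 2 Xs (frame a) H M :=
  hP.toCop Nat.prime_two two_eq_zero_stalk

end JetModel

end Summit.ResolutionOfSingularities.ResolutionOfSingularities.Theorems.DeltaCutClasses
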